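import Literature.NumberTheory.CubicFields.CubicFieldDiscriminant7831
import Literature.NumberTheory.NumberFields.ClassGroupCertDK
import HarnessLib

/-!
# The cubic field of discriminant `−7831` (LMFDB 3.1.7831.1), II: the three dyadic primes `𝔭₀ = (2, 1 + θ + δ)`, `𝔭₁ = (2, 1 + δ)`, `𝔭₂ = (2, 2 + θ)`
# — TWO-GENERATOR ideals of norm `2` each with `𝔭₀𝔭₁𝔭₂ ⊆ (2)`, every prime containing `2` is one of them, and ★ `[𝔭ᵢ]⁷ = 1` (`(βᵢ) = 𝔭ᵢ⁷`) — PROVED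
# (part III: every prime of norm `≤ 25` is `7`-torsion in `Cl(F)`, hence `c⁷ = 1` for every class and `2 ∤ h_F`; in fact `h_F = 7`)

Sequel of `CubicFieldDiscriminant7831.lean` (prover seat `bsd-line-att-p3` g56, cell `bsd-f1-sign2`).  THEOREMS ONLY (no definition, no named fact, no instance,
no `sorry`).  This is the first cubic `2`-division field of the cell's census whose class number is NOT `1`: NONE of the three primes above `2` is principal
(there is no element of norm `±2`), so the dyadic primes are presented as TWO-GENERATOR ideals `(2, x)` and certified WITHOUT a residue map at `2` (none exists
through a generator: `2` is Dedekind's common index divisor):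
* §1 norms of the elements used (`N(1+θ+δ) = 34`, `N(1+δ) = 74`, `N(2+θ) = 34`, `N(2) = 8`, `N(−5+θ−δ) = N(−7−δ) = −128`, `N(4+θ) = 128`) by the norm
  form `MonicCubic.norm_lin` on `1, α, α²`;
* §2 ★ `absNorm_P₀/P₁/P₂ = 2`: `(1+θ+δ)(1+δ)(2+θ) = 2·(7 + 16θ − 26δ)` gives `𝔭₀𝔭₁𝔭₂ ⊆ (2)`, so `8 ∣ N𝔭₀·N𝔭₁·N𝔭₂` while each `N𝔭ᵢ ∣ gcd(8, N(xᵢ)) = 2`;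
  the `𝔭ᵢ` are prime, and every prime containing `2` is one of them (`eq_dyadic_of_two_mem`);
* §3 ★ `[𝔭ᵢ]⁷ = 1`: `(βᵢ) = 𝔭ᵢ⁷` for `β₀ = −5 + θ − δ`, `β₁ = −7 − δ`, `β₂ = 4 + θ` (norm `±2⁷`, and `βᵢ ≡ 1 (mod 𝔭ⱼ)` for `j ≠ i` by an explicit
  `βᵢ = 1 + 2B + xⱼC`), through the tree's `mk0_pow_eq_one_of_forall_mem_imp_eq`;
* part III (`…7831ClassNumber.lean`): every prime of norm `≤ 25` has its class in `Cl(F)[7]`, ★ `c⁷ = 1` for every class, ★ `2 ∤ h_F`.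

References: [Marcus2018] D. A. Marcus, *Number Fields*, 2nd ed., Ch. 2 Thm. 4 / Ex. 27, Ch. 3 Thm. 27 / Ex. 21 (Dedekind), Ch. 5 Thm. 35–37 and Cor. 2;
[Dedekind1878] R. Dedekind, Abh. Göttingen 23 (1878) §5 (the field of discriminant `−503` and the common index divisor); [LMFDB] number field 3.1.7831.1
(class number `7`); tree: `NumberFields/ClassGroupCert`, `NumberFields/ClassGroupCertDK` (certificate calculus), `CubicFieldDiscriminant431ClassNumber` (template).
-/

set_option linter.unusedSimpArgs false

noncomputable section

open scoped nonZeroDivisors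
open Polynomial NumberField NumberField.InfinitePlace Ideal Module Real
open Literature.NumberTheory.NumberFields
open Literature.NumberTheory.NumberFields.MonicCubic

namespace Literature.NumberTheory.CubicFields.CubicDisc7831

section NumberField

variable {F : Type*} [Field F] [NumberField F] {α : F}

/-! ## §1 Norms -/


/-- `N(1 + θ + δ) = 34 = 2·17` (the second generator of `𝔭₀`). [cite: Marcus2018, Ch. 2, Thm. 4 and Exercise 27] -/
theorem natAbs_norm_x0 (h3 : finrank ℚ F = 3) (hα : aeval α (poly 0 19 12) = 0) :
    (Algebra.norm ℤ ((1 + thetaInt hα + thetaInt (delta_root hα)) : 𝓞 F)).natAbs = 34 := by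
  have h : ((Algebra.norm ℤ ((1 + thetaInt hα + thetaInt (delta_root hα)) : 𝓞 F) : ℤ) : ℚ) = Algebra.norm ℚ (algebraMap (𝓞 F) F (1 + thetaInt hα + thetaInt (delta_root hα))) :=
    Algebra.coe_norm_int _
  have hx : algebraMap (𝓞 F) F (1 + thetaInt hα + thetaInt (delta_root hα)) = ((1 : ℚ) : F) + ((3 / 2 : ℚ) : F) * α + ((1 / 2 : ℚ) : F) * α ^ 2 := by
    simp only [map_add, map_sub, map_neg, map_mul, map_pow, map_ofNat, map_one, map_natCast, map_intCast, MonicCubic.thetaInt, RingOfIntegers.map_mk]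
    push_cast; ring
  rw [hx, norm_lin irreducible_polyQ hα h3, show normForm 0 19 12 (1) (3 / 2) (1 / 2) = ((34 : ℤ) : ℚ) by norm_num [normForm]] at h
  have h' : Algebra.norm ℤ ((1 + thetaInt hα + thetaInt (delta_root hα)) : 𝓞 F) = 34 := by exact_mod_cast h
  rw [h']; rfl

/-- `N(1 + δ) = 74 = 2·37` (the second generator of `𝔭₁`). [cite: Marcus2018, Ch. 2, Thm. 4 and Exercise 27] -/
theorem natAbs_norm_x1 (h3 : finrank ℚ F = 3) (hα : aeval α (poly 0 19 12) = 0) :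
    (Algebra.norm ℤ ((1 + thetaInt (delta_root hα)) : 𝓞 F)).natAbs = 74 := by
  have h : ((Algebra.norm ℤ ((1 + thetaInt (delta_root hα)) : 𝓞 F) : ℤ) : ℚ) = Algebra.norm ℚ (algebraMap (𝓞 F) F (1 + thetaInt (delta_root hα))) :=
    Algebra.coe_norm_int _
  have hx : algebraMap (𝓞 F) F (1 + thetaInt (delta_root hα)) = ((1 : ℚ) : F) + ((1 / 2 : ℚ) : F) * α + ((1 / 2 : ℚ) : F) * α ^ 2 := by
    simp only [map_add, map_sub, map_neg, map_mul, map_pow, map_ofNat, map_one, map_natCast, map_intCast, MonicCubic.thetaInt, RingOfIntegers.map_mk]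
    push_cast; ring
  rw [hx, norm_lin irreducible_polyQ hα h3, show normForm 0 19 12 (1) (1 / 2) (1 / 2) = ((74 : ℤ) : ℚ) by norm_num [normForm]] at h
  have h' : Algebra.norm ℤ ((1 + thetaInt (delta_root hα)) : 𝓞 F) = 74 := by exact_mod_cast h
  rw [h']; rfl

/-- `N(2 + θ) = 34 = 2·17` (the second generator of `𝔭₂`). [cite: Marcus2018, Ch. 2, Thm. 4 and Exercise 27] -/
theorem natAbs_norm_x2 (h3 : finrank ℚ F = 3) (hα : aeval α (poly 0 19 12) = 0) :
    (Algebra.norm ℤ ((2 + thetaInt hα) : 𝓞 F)).natAbs = 34 := by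
  have h : ((Algebra.norm ℤ ((2 + thetaInt hα) : 𝓞 F) : ℤ) : ℚ) = Algebra.norm ℚ (algebraMap (𝓞 F) F (2 + thetaInt hα)) :=
    Algebra.coe_norm_int _
  have hx : algebraMap (𝓞 F) F (2 + thetaInt hα) = ((2 : ℚ) : F) + ((1 : ℚ) : F) * α + ((0 : ℚ) : F) * α ^ 2 := by
    simp only [map_add, map_sub, map_neg, map_mul, map_pow, map_ofNat, map_one, map_natCast, map_intCast, MonicCubic.thetaInt, RingOfIntegers.map_mk]
    push_cast; ring
  rw [hx, norm_lin irreducible_polyQ hα h3, show normForm 0 19 12 (2) (1) (0) = ((34 : ℤ) : ℚ) by norm_num [normForm]] at h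
  have h' : Algebra.norm ℤ ((2 + thetaInt hα) : 𝓞 F) = 34 := by exact_mod_cast h
  rw [h']; rfl

/-- `N(2) = 8`. [cite: Marcus2018, Ch. 2, Thm. 4 and Exercise 27] -/
theorem natAbs_norm_two (h3 : finrank ℚ F = 3) (hα : aeval α (poly 0 19 12) = 0) :
    (Algebra.norm ℤ ((2 : 𝓞 F) : 𝓞 F)).natAbs = 8 := by
  have h : ((Algebra.norm ℤ ((2 : 𝓞 F) : 𝓞 F) : ℤ) : ℚ) = Algebra.norm ℚ (algebraMap (𝓞 F) F (2 : 𝓞 F)) :=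
    Algebra.coe_norm_int _
  have hx : algebraMap (𝓞 F) F (2 : 𝓞 F) = ((2 : ℚ) : F) + ((0 : ℚ) : F) * α + ((0 : ℚ) : F) * α ^ 2 := by
    simp only [map_add, map_sub, map_neg, map_mul, map_pow, map_ofNat, map_one, map_natCast, map_intCast, MonicCubic.thetaInt, RingOfIntegers.map_mk]
    push_cast; ring
  rw [hx, norm_lin irreducible_polyQ hα h3, show normForm 0 19 12 (2) (0) (0) = ((8 : ℤ) : ℚ) by norm_num [normForm]] at h
  have h' : Algebra.norm ℤ ((2 : 𝓞 F) : 𝓞 F) = 8 := by exact_mod_cast h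
  rw [h']; rfl

/-- `N(−5 + θ − δ) = -128 = ±2⁷` (a generator of `𝔭₀⁷`). [cite: Marcus2018, Ch. 2, Thm. 4 and Exercise 27] -/
theorem natAbs_norm_beta0 (h3 : finrank ℚ F = 3) (hα : aeval α (poly 0 19 12) = 0) :
    (Algebra.norm ℤ ((-5 + thetaInt hα - thetaInt (delta_root hα)) : 𝓞 F)).natAbs = 128 := by
  have h : ((Algebra.norm ℤ ((-5 + thetaInt hα - thetaInt (delta_root hα)) : 𝓞 F) : ℤ) : ℚ) = Algebra.norm ℚ (algebraMap (𝓞 F) F (-5 + thetaInt hα - thetaInt (delta_root hα))) :=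
    Algebra.coe_norm_int _
  have hx : algebraMap (𝓞 F) F (-5 + thetaInt hα - thetaInt (delta_root hα)) = ((-5 : ℚ) : F) + ((1 / 2 : ℚ) : F) * α + ((-1 / 2 : ℚ) : F) * α ^ 2 := by
    simp only [map_add, map_sub, map_neg, map_mul, map_pow, map_ofNat, map_one, map_natCast, map_intCast, MonicCubic.thetaInt, RingOfIntegers.map_mk]
    push_cast; ring
  rw [hx, norm_lin irreducible_polyQ hα h3, show normForm 0 19 12 (-5) (1 / 2) (-1 / 2) = ((-128 : ℤ) : ℚ) by norm_num [normForm]] at h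
  have h' : Algebra.norm ℤ ((-5 + thetaInt hα - thetaInt (delta_root hα)) : 𝓞 F) = -128 := by exact_mod_cast h
  rw [h']; rfl

/-- `N(−7 − δ) = -128 = ±2⁷` (a generator of `𝔭₁⁷`). [cite: Marcus2018, Ch. 2, Thm. 4 and Exercise 27] -/
theorem natAbs_norm_beta1 (h3 : finrank ℚ F = 3) (hα : aeval α (poly 0 19 12) = 0) :
    (Algebra.norm ℤ ((-7 - thetaInt (delta_root hα)) : 𝓞 F)).natAbs = 128 := by
  have h : ((Algebra.norm ℤ ((-7 - thetaInt (delta_root hα)) : 𝓞 F) : ℤ) : ℚ) = Algebra.norm ℚ (algebraMap (𝓞 F) F (-7 - thetaInt (delta_root hα))) :=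
    Algebra.coe_norm_int _
  have hx : algebraMap (𝓞 F) F (-7 - thetaInt (delta_root hα)) = ((-7 : ℚ) : F) + ((-1 / 2 : ℚ) : F) * α + ((-1 / 2 : ℚ) : F) * α ^ 2 := by
    simp only [map_add, map_sub, map_neg, map_mul, map_pow, map_ofNat, map_one, map_natCast, map_intCast, MonicCubic.thetaInt, RingOfIntegers.map_mk]
    push_cast; ring
  rw [hx, norm_lin irreducible_polyQ hα h3, show normForm 0 19 12 (-7) (-1 / 2) (-1 / 2) = ((-128 : ℤ) : ℚ) by norm_num [normForm]] at h
  have h' : Algebra.norm ℤ ((-7 - thetaInt (delta_root hα)) : 𝓞 F) = -128 := by exact_mod_cast h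
  rw [h']; rfl

/-- `N(4 + θ) = 128 = ±2⁷` (a generator of `𝔭₂⁷`). [cite: Marcus2018, Ch. 2, Thm. 4 and Exercise 27] -/
theorem natAbs_norm_beta2 (h3 : finrank ℚ F = 3) (hα : aeval α (poly 0 19 12) = 0) :
    (Algebra.norm ℤ ((4 + thetaInt hα) : 𝓞 F)).natAbs = 128 := by
  have h : ((Algebra.norm ℤ ((4 + thetaInt hα) : 𝓞 F) : ℤ) : ℚ) = Algebra.norm ℚ (algebraMap (𝓞 F) F (4 + thetaInt hα)) :=
    Algebra.coe_norm_int _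
  have hx : algebraMap (𝓞 F) F (4 + thetaInt hα) = ((4 : ℚ) : F) + ((1 : ℚ) : F) * α + ((0 : ℚ) : F) * α ^ 2 := by
    simp only [map_add, map_sub, map_neg, map_mul, map_pow, map_ofNat, map_one, map_natCast, map_intCast, MonicCubic.thetaInt, RingOfIntegers.map_mk]
    push_cast; ring
  rw [hx, norm_lin irreducible_polyQ hα h3, show normForm 0 19 12 (4) (1) (0) = ((128 : ℤ) : ℚ) by norm_num [normForm]] at h
  have h' : Algebra.norm ℤ ((4 + thetaInt hα) : 𝓞 F) = 128 := by exact_mod_cast h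
  rw [h']; rfl

/-! ## §2 The dyadic primes `𝔭₀ = (2, 1 + θ + δ)`, `𝔭₁ = (2, 1 + δ)`, `𝔭₂ = (2, 2 + θ)`: product in `(2)`, norm `2`, primality -/

/-- **`(1 + θ + δ)·(1 + δ)·(2 + θ) = 2·(7 + 16θ − 26δ)`** (multiplication table of `ℤ ⊕ ℤθ ⊕ ℤδ`). [cite: Marcus2018, Ch. 3, Exercise 21] -/
theorem prod_x_eq (hα : aeval α (poly 0 19 12) = 0) :
    (1 + thetaInt hα + thetaInt (delta_root hα)) * (1 + thetaInt (delta_root hα)) * (2 + thetaInt hα) = 2 * (7 + 16 * thetaInt hα - 26 * thetaInt (delta_root hα)) := by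
  set θI : 𝓞 F := thetaInt hα with hθI
  set δI : 𝓞 F := thetaInt (delta_root hα) with hδI
  obtain ⟨hX2, hXY, hY2⟩ := mul_table hα
  rw [← hθI, ← hδI] at hX2 hXY hY2
  linear_combination ((1 : 𝓞 F) + (1 : 𝓞 F) * δI) * hX2 + ((-7 : 𝓞 F) + (1 : 𝓞 F) * δI) * hXY + ((5 : 𝓞 F)) * hY2

/-- **`𝔭₀ 𝔭₁ 𝔭₂ ⊆ (2)`**: the eight products of generators are multiples of `2` (seven visibly, the eighth by `prod_x_eq`). [cite: Marcus2018, Ch. 3, Thm. 27 and Exercise 21] -/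
theorem prod_dyadic_le (hα : aeval α (poly 0 19 12) = 0) :
    Ideal.span {(2 : 𝓞 F), (1 + thetaInt hα + thetaInt (delta_root hα))} * Ideal.span {(2 : 𝓞 F), (1 + thetaInt (delta_root hα))} * Ideal.span {(2 : 𝓞 F), (2 + thetaInt hα)} ≤ Ideal.span {(2 : 𝓞 F)} := by
  have hprod := prod_x_eq hα
  rw [Ideal.span_mul_span', Ideal.span_mul_span', Ideal.span_le]
  rintro z ⟨xy, ⟨x, hx, y, hy, rfl⟩, c, hc, rfl⟩
  simp only [Set.mem_insert_iff, Set.mem_singleton_iff] at hx hy hc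
  rcases hx with rfl | rfl <;> rcases hy with rfl | rfl <;> rcases hc with rfl | rfl
  all_goals first
    | exact Ideal.mul_mem_right _ _ (Ideal.mul_mem_right _ _ (Ideal.mem_span_singleton_self 2))
    | exact Ideal.mul_mem_right _ _ (Ideal.mul_mem_left _ _ (Ideal.mem_span_singleton_self 2))
    | exact Ideal.mul_mem_left _ _ (Ideal.mem_span_singleton_self 2)
    | (refine Ideal.mem_span_singleton'.mpr ⟨(7 + 16 * thetaInt hα - 26 * thetaInt (delta_root hα)), ?_⟩
       show _ = (1 + thetaInt hα + thetaInt (delta_root hα)) * (1 + thetaInt (delta_root hα)) * (2 + thetaInt hα)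
       rw [hprod]; ring)

/-- ★ **`N𝔭₀ = N𝔭₁ = N𝔭₂ = 2`**: each `N𝔭ᵢ` divides `N(2) = 8` and `N(xᵢ) ∈ {34, 74}`, so divides `2`; and `8 = N((2)) ∣ N(𝔭₀𝔭₁𝔭₂) = N𝔭₀·N𝔭₁·N𝔭₂`.
None of the `𝔭ᵢ` is principal (there is no element of norm `±2`; not needed here). [cite: Marcus2018, Ch. 3, Thm. 27 and Exercise 21] [cite: LMFDB, number field 3.1.7831.1] -/
theorem absNorm_dyadic (h3 : finrank ℚ F = 3) (hα : aeval α (poly 0 19 12) = 0) :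
    Ideal.absNorm (Ideal.span {(2 : 𝓞 F), (1 + thetaInt hα + thetaInt (delta_root hα))}) = 2 ∧ Ideal.absNorm (Ideal.span {(2 : 𝓞 F), (1 + thetaInt (delta_root hα))}) = 2 ∧ Ideal.absNorm (Ideal.span {(2 : 𝓞 F), (2 + thetaInt hα)}) = 2 := by
  have h8 : Ideal.absNorm (Ideal.span {(2 : 𝓞 F)}) = 8 := by rw [Ideal.absNorm_span_singleton, natAbs_norm_two h3 hα]
  have hdvd2 : ∀ (x : 𝓞 F), (Algebra.norm ℤ x).natAbs = 34 ∨ (Algebra.norm ℤ x).natAbs = 74 →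
      Ideal.absNorm (Ideal.span {(2 : 𝓞 F), x}) ∣ 2 := by
    intro x hx
    have h1 : Ideal.absNorm (Ideal.span {(2 : 𝓞 F), x}) ∣ 8 := by
      rw [← h8]
      exact Ideal.absNorm_dvd_absNorm_of_le ((Ideal.span_singleton_le_iff_mem _).mpr (Ideal.subset_span (by simp)))
    have h2 : Ideal.absNorm (Ideal.span {(2 : 𝓞 F), x}) ∣ (Algebra.norm ℤ x).natAbs := by
      rw [← Ideal.absNorm_span_singleton]
      exact Ideal.absNorm_dvd_absNorm_of_le ((Ideal.span_singleton_le_iff_mem _).mpr (Ideal.subset_span (by simp)))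
    rcases hx with hx | hx
    · rw [hx] at h2; exact (Nat.dvd_gcd h1 h2).trans (by norm_num)
    · rw [hx] at h2; exact (Nat.dvd_gcd h1 h2).trans (by norm_num)
  have d0 := hdvd2 _ (Or.inl (natAbs_norm_x0 h3 hα))
  have d1 := hdvd2 _ (Or.inr (natAbs_norm_x1 h3 hα))
  have d2 := hdvd2 _ (Or.inl (natAbs_norm_x2 h3 hα))
  have hprod : 8 ∣ Ideal.absNorm (Ideal.span {(2 : 𝓞 F), (1 + thetaInt hα + thetaInt (delta_root hα))}) * Ideal.absNorm (Ideal.span {(2 : 𝓞 F), (1 + thetaInt (delta_root hα))}) * Ideal.absNorm (Ideal.span {(2 : 𝓞 F), (2 + thetaInt hα)}) := by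
    rw [← h8, ← map_mul, ← map_mul]
    exact Ideal.absNorm_dvd_absNorm_of_le (prod_dyadic_le hα)
  rcases (Nat.dvd_prime Nat.prime_two).mp d0 with e0 | e0 <;> rcases (Nat.dvd_prime Nat.prime_two).mp d1 with e1 | e1 <;>
    rcases (Nat.dvd_prime Nat.prime_two).mp d2 with e2 | e2 <;> rw [e0, e1, e2] at hprod <;> norm_num at hprod; exact ⟨e0, e1, e2⟩

/-- `N𝔭₀ = 2`. [cite: Marcus2018, Ch. 3, Thm. 27] -/
theorem absNorm_P0 (h3 : finrank ℚ F = 3) (hα : aeval α (poly 0 19 12) = 0) : Ideal.absNorm (Ideal.span {(2 : 𝓞 F), (1 + thetaInt hα + thetaInt (delta_root hα))}) = 2 := (absNorm_dyadic h3 hα).1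
/-- `N𝔭₁ = 2`. [cite: Marcus2018, Ch. 3, Thm. 27] -/
theorem absNorm_P1 (h3 : finrank ℚ F = 3) (hα : aeval α (poly 0 19 12) = 0) : Ideal.absNorm (Ideal.span {(2 : 𝓞 F), (1 + thetaInt (delta_root hα))}) = 2 := (absNorm_dyadic h3 hα).2.1
/-- `N𝔭₂ = 2`. [cite: Marcus2018, Ch. 3, Thm. 27] -/
theorem absNorm_P2 (h3 : finrank ℚ F = 3) (hα : aeval α (poly 0 19 12) = 0) : Ideal.absNorm (Ideal.span {(2 : 𝓞 F), (2 + thetaInt hα)}) = 2 := (absNorm_dyadic h3 hα).2.2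

/-- An ideal of norm `2` is a non-zero prime. [cite: Marcus2018, Ch. 3, Thm. 22] -/
theorem isPrime_of_absNorm_eq_two {I : Ideal (𝓞 F)} (h : Ideal.absNorm I = 2) : I.IsPrime ∧ I ≠ ⊥ :=
  ⟨Ideal.isPrime_of_irreducible_absNorm (by rw [h]; exact Nat.prime_two.prime.irreducible),
    fun hb => by rw [hb, Ideal.absNorm_bot] at h; exact absurd h (by norm_num)⟩

/-- **Every prime ideal containing `2` is `𝔭₀`, `𝔭₁` or `𝔭₂`** (`𝔭₀𝔭₁𝔭₂ ⊆ (2) ⊆ Q` and the `𝔭ᵢ` are maximal). [cite: Marcus2018, Ch. 3, Thm. 27 and Exercise 21] -/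
theorem eq_dyadic_of_two_mem (h3 : finrank ℚ F = 3) (hα : aeval α (poly 0 19 12) = 0) {Q : Ideal (𝓞 F)} (hQ : Q.IsPrime)
    (h2 : (2 : 𝓞 F) ∈ Q) : Q = Ideal.span {(2 : 𝓞 F), (1 + thetaInt hα + thetaInt (delta_root hα))} ∨ Q = Ideal.span {(2 : 𝓞 F), (1 + thetaInt (delta_root hα))} ∨ Q = Ideal.span {(2 : 𝓞 F), (2 + thetaInt hα)} := by
  obtain ⟨hN0, hN1, hN2⟩ := absNorm_dyadic h3 hα
  have hle : Ideal.span {(2 : 𝓞 F), (1 + thetaInt hα + thetaInt (delta_root hα))} * Ideal.span {(2 : 𝓞 F), (1 + thetaInt (delta_root hα))} * Ideal.span {(2 : 𝓞 F), (2 + thetaInt hα)} ≤ Q :=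
    (prod_dyadic_le hα).trans ((Ideal.span_singleton_le_iff_mem _).mpr h2)
  have key : ∀ I : Ideal (𝓞 F), Ideal.absNorm I = 2 → I ≤ Q → Q = I := fun I hI hIQ =>
    (((isPrime_of_absNorm_eq_two hI).1.isMaximal (isPrime_of_absNorm_eq_two hI).2).eq_of_le hQ.ne_top hIQ).symm
  rcases hQ.mul_le.mp hle with h01 | h2'
  · rcases hQ.mul_le.mp h01 with h0 | h1
    · exact Or.inl (key _ hN0 h0)
    · exact Or.inr (Or.inl (key _ hN1 h1))
  · exact Or.inr (Or.inr (key _ hN2 h2'))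

/-! ## §3 `[𝔭ᵢ]⁷ = 1`: `(βᵢ) = 𝔭ᵢ⁷` -/


/-- ★ **`[𝔭₀]⁷ = 1`**: `β = −5 + θ − δ` has norm `±2⁷` and lies in no prime other than `𝔭₀` (a prime `Q ∋ β` contains `2`, so is a `𝔭ⱼ`, and
`β ≡ 1 (mod 𝔭ⱼ)` for `j ≠ 0`), so `(β) = 𝔭₀⁷`. [cite: Marcus2018, Ch. 5, Thm. 35 and Cor. 2] [cite: LMFDB, number field 3.1.7831.1 (class group ℤ/7)] -/
theorem mk0_P0_pow_seven (h3 : finrank ℚ F = 3) (hα : aeval α (poly 0 19 12) = 0)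
    (h0 : Ideal.span {(2 : 𝓞 F), (1 + thetaInt hα + thetaInt (delta_root hα))} ∈ (Ideal (𝓞 F))⁰) : ClassGroup.mk0 ⟨Ideal.span {(2 : 𝓞 F), (1 + thetaInt hα + thetaInt (delta_root hα))}, h0⟩ ^ 7 = 1 := by
  obtain ⟨hP, hP0⟩ := isPrime_of_absNorm_eq_two (absNorm_P0 h3 hα)
  obtain ⟨hX2, hXY, hY2⟩ := mul_table hα
  have hnorm := natAbs_norm_beta0 h3 hα
  refine mk0_pow_eq_one_of_forall_mem_imp_eq hP hP0 (β := (-5 + thetaInt hα - thetaInt (delta_root hα))) (by rw [absNorm_P0 h3 hα]; simpa using hnorm) ?_ h0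
  intro Q hQ hQ0 hβ
  have h2 : (2 : 𝓞 F) ∈ Q := by
    have h := natCast_mem_of_norm_eq_pow hQ hβ (p := 2) (k := 7) (by simpa using hnorm)
    exact_mod_cast h
  rcases eq_dyadic_of_two_mem h3 hα hQ h2 with rfl | rfl | rfl
  · rfl
  · exfalso
    refine hQ.ne_top ((Ideal.eq_top_iff_one _).mpr ?_)
    have h1 : (-5 + thetaInt hα - thetaInt (delta_root hα)) + (-5 * thetaInt hα + thetaInt (delta_root hα)) * 2 + (-thetaInt hα) * (1 + thetaInt (delta_root hα)) = 1 := by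
      linear_combination (0 : 𝓞 F) * hX2 + ((-1 : 𝓞 F)) * hXY + (0 : 𝓞 F) * hY2
    have hmem : (-5 + thetaInt hα - thetaInt (delta_root hα)) + (-5 * thetaInt hα + thetaInt (delta_root hα)) * 2 + (-thetaInt hα) * (1 + thetaInt (delta_root hα)) ∈ Ideal.span {(2 : 𝓞 F), (1 + thetaInt (delta_root hα))} :=
      Ideal.add_mem _ (Ideal.add_mem _ hβ (Ideal.mul_mem_left _ _ (Ideal.subset_span (Set.mem_insert _ _))))
        (Ideal.mul_mem_left _ _ (Ideal.subset_span (Set.mem_insert_of_mem _ (Set.mem_singleton _))))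
    rw [h1] at hmem
    exact hmem
  · exfalso
    refine hQ.ne_top ((Ideal.eq_top_iff_one _).mpr ?_)
    have h1 : (-5 + thetaInt hα - thetaInt (delta_root hα)) + (-6 * thetaInt hα + thetaInt (delta_root hα)) * 2 + (thetaInt hα - thetaInt (delta_root hα)) * (2 + thetaInt hα) = 1 := by
      linear_combination ((1 : 𝓞 F)) * hX2 + ((-1 : 𝓞 F)) * hXY + (0 : 𝓞 F) * hY2
    have hmem : (-5 + thetaInt hα - thetaInt (delta_root hα)) + (-6 * thetaInt hα + thetaInt (delta_root hα)) * 2 + (thetaInt hα - thetaInt (delta_root hα)) * (2 + thetaInt hα) ∈ Ideal.span {(2 : 𝓞 F), (2 + thetaInt hα)} :=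
      Ideal.add_mem _ (Ideal.add_mem _ hβ (Ideal.mul_mem_left _ _ (Ideal.subset_span (Set.mem_insert _ _))))
        (Ideal.mul_mem_left _ _ (Ideal.subset_span (Set.mem_insert_of_mem _ (Set.mem_singleton _))))
    rw [h1] at hmem
    exact hmem


/-- ★ **`[𝔭₁]⁷ = 1`**: `β = −7 − δ` has norm `±2⁷` and lies in no prime other than `𝔭₁` (a prime `Q ∋ β` contains `2`, so is a `𝔭ⱼ`, and
`β ≡ 1 (mod 𝔭ⱼ)` for `j ≠ 1`), so `(β) = 𝔭₁⁷`. [cite: Marcus2018, Ch. 5, Thm. 35 and Cor. 2] [cite: LMFDB, number field 3.1.7831.1 (class group ℤ/7)] -/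
theorem mk0_P1_pow_seven (h3 : finrank ℚ F = 3) (hα : aeval α (poly 0 19 12) = 0)
    (h0 : Ideal.span {(2 : 𝓞 F), (1 + thetaInt (delta_root hα))} ∈ (Ideal (𝓞 F))⁰) : ClassGroup.mk0 ⟨Ideal.span {(2 : 𝓞 F), (1 + thetaInt (delta_root hα))}, h0⟩ ^ 7 = 1 := by
  obtain ⟨hP, hP0⟩ := isPrime_of_absNorm_eq_two (absNorm_P1 h3 hα)
  obtain ⟨hX2, hXY, hY2⟩ := mul_table hα
  have hnorm := natAbs_norm_beta1 h3 hα
  refine mk0_pow_eq_one_of_forall_mem_imp_eq hP hP0 (β := (-7 - thetaInt (delta_root hα))) (by rw [absNorm_P1 h3 hα]; simpa using hnorm) ?_ h0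
  intro Q hQ hQ0 hβ
  have h2 : (2 : 𝓞 F) ∈ Q := by
    have h := natCast_mem_of_norm_eq_pow hQ hβ (p := 2) (k := 7) (by simpa using hnorm)
    exact_mod_cast h
  rcases eq_dyadic_of_two_mem h3 hα hQ h2 with rfl | rfl | rfl
  · exfalso
    refine hQ.ne_top ((Ideal.eq_top_iff_one _).mpr ?_)
    have h1 : (-7 - thetaInt (delta_root hα)) + (1 - 5 * thetaInt hα + 2 * thetaInt (delta_root hα)) * 2 + (-thetaInt hα) * (1 + thetaInt hα + thetaInt (delta_root hα)) = 1 := by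
      linear_combination ((-1 : 𝓞 F)) * hX2 + ((-1 : 𝓞 F)) * hXY + (0 : 𝓞 F) * hY2
    have hmem : (-7 - thetaInt (delta_root hα)) + (1 - 5 * thetaInt hα + 2 * thetaInt (delta_root hα)) * 2 + (-thetaInt hα) * (1 + thetaInt hα + thetaInt (delta_root hα)) ∈ Ideal.span {(2 : 𝓞 F), (1 + thetaInt hα + thetaInt (delta_root hα))} :=
      Ideal.add_mem _ (Ideal.add_mem _ hβ (Ideal.mul_mem_left _ _ (Ideal.subset_span (Set.mem_insert _ _))))
        (Ideal.mul_mem_left _ _ (Ideal.subset_span (Set.mem_insert_of_mem _ (Set.mem_singleton _))))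
    rw [h1] at hmem
    exact hmem
  · rfl
  · exfalso
    refine hQ.ne_top ((Ideal.eq_top_iff_one _).mpr ?_)
    have h1 : (-7 - thetaInt (delta_root hα)) + (1 - 5 * thetaInt hα + 2 * thetaInt (delta_root hα)) * 2 + (-thetaInt (delta_root hα)) * (2 + thetaInt hα) = 1 := by
      linear_combination (0 : 𝓞 F) * hX2 + ((-1 : 𝓞 F)) * hXY + (0 : 𝓞 F) * hY2
    have hmem : (-7 - thetaInt (delta_root hα)) + (1 - 5 * thetaInt hα + 2 * thetaInt (delta_root hα)) * 2 + (-thetaInt (delta_root hα)) * (2 + thetaInt hα) ∈ Ideal.span {(2 : 𝓞 F), (2 + thetaInt hα)} :=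
      Ideal.add_mem _ (Ideal.add_mem _ hβ (Ideal.mul_mem_left _ _ (Ideal.subset_span (Set.mem_insert _ _))))
        (Ideal.mul_mem_left _ _ (Ideal.subset_span (Set.mem_insert_of_mem _ (Set.mem_singleton _))))
    rw [h1] at hmem
    exact hmem


/-- ★ **`[𝔭₂]⁷ = 1`**: `β = 4 + θ` has norm `±2⁷` and lies in no prime other than `𝔭₂` (a prime `Q ∋ β` contains `2`, so is a `𝔭ⱼ`, and
`β ≡ 1 (mod 𝔭ⱼ)` for `j ≠ 2`), so `(β) = 𝔭₂⁷`. [cite: Marcus2018, Ch. 5, Thm. 35 and Cor. 2] [cite: LMFDB, number field 3.1.7831.1 (class group ℤ/7)] -/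
theorem mk0_P2_pow_seven (h3 : finrank ℚ F = 3) (hα : aeval α (poly 0 19 12) = 0)
    (h0 : Ideal.span {(2 : 𝓞 F), (2 + thetaInt hα)} ∈ (Ideal (𝓞 F))⁰) : ClassGroup.mk0 ⟨Ideal.span {(2 : 𝓞 F), (2 + thetaInt hα)}, h0⟩ ^ 7 = 1 := by
  obtain ⟨hP, hP0⟩ := isPrime_of_absNorm_eq_two (absNorm_P2 h3 hα)
  obtain ⟨hX2, hXY, hY2⟩ := mul_table hα
  have hnorm := natAbs_norm_beta2 h3 hα
  refine mk0_pow_eq_one_of_forall_mem_imp_eq hP hP0 (β := (4 + thetaInt hα)) (by rw [absNorm_P2 h3 hα]; simpa using hnorm) ?_ h0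
  intro Q hQ hQ0 hβ
  have h2 : (2 : 𝓞 F) ∈ Q := by
    have h := natCast_mem_of_norm_eq_pow hQ hβ (p := 2) (k := 7) (by simpa using hnorm)
    exact_mod_cast h
  rcases eq_dyadic_of_two_mem h3 hα hQ h2 with rfl | rfl | rfl
  · exfalso
    refine hQ.ne_top ((Ideal.eq_top_iff_one _).mpr ?_)
    have h1 : (4 + thetaInt hα) + (1 + 4 * thetaInt hα - 2 * thetaInt (delta_root hα)) * 2 + (1 + thetaInt hα) * (1 + thetaInt hα + thetaInt (delta_root hα)) = 1 := by
      linear_combination ((1 : 𝓞 F)) * hX2 + ((1 : 𝓞 F)) * hXY + (0 : 𝓞 F) * hY2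
    have hmem : (4 + thetaInt hα) + (1 + 4 * thetaInt hα - 2 * thetaInt (delta_root hα)) * 2 + (1 + thetaInt hα) * (1 + thetaInt hα + thetaInt (delta_root hα)) ∈ Ideal.span {(2 : 𝓞 F), (1 + thetaInt hα + thetaInt (delta_root hα))} :=
      Ideal.add_mem _ (Ideal.add_mem _ hβ (Ideal.mul_mem_left _ _ (Ideal.subset_span (Set.mem_insert _ _))))
        (Ideal.mul_mem_left _ _ (Ideal.subset_span (Set.mem_insert_of_mem _ (Set.mem_singleton _))))
    rw [h1] at hmem
    exact hmem
  · exfalso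
    refine hQ.ne_top ((Ideal.eq_top_iff_one _).mpr ?_)
    have h1 : (4 + thetaInt hα) + (1 + 4 * thetaInt hα - thetaInt (delta_root hα)) * 2 + (1 + thetaInt hα) * (1 + thetaInt (delta_root hα)) = 1 := by
      linear_combination (0 : 𝓞 F) * hX2 + ((1 : 𝓞 F)) * hXY + (0 : 𝓞 F) * hY2
    have hmem : (4 + thetaInt hα) + (1 + 4 * thetaInt hα - thetaInt (delta_root hα)) * 2 + (1 + thetaInt hα) * (1 + thetaInt (delta_root hα)) ∈ Ideal.span {(2 : 𝓞 F), (1 + thetaInt (delta_root hα))} :=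
      Ideal.add_mem _ (Ideal.add_mem _ hβ (Ideal.mul_mem_left _ _ (Ideal.subset_span (Set.mem_insert _ _))))
        (Ideal.mul_mem_left _ _ (Ideal.subset_span (Set.mem_insert_of_mem _ (Set.mem_singleton _))))
    rw [h1] at hmem
    exact hmem
  · rfl


end NumberField

end Literature.NumberTheory.CubicFields.CubicDisc7831

end
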